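import Mathlib.Algebra.Order.Antidiag.FinsuppEquiv
import Mathlib.Algebra.MvPolynomial.Coeff
import Mathlib.Data.Nat.Choose.Multinomial
import Mathlib.Tactic
import HarnessLib

/-!
# Balanced multi-indices: `#V_m^d = binom(d; d/m,…,d/m) ≥ m^d / C(d+m−1, m−1)` (CDT Lemma 60)

Calegari–Dimitrov–Tang, arXiv:2408.15403, §6.2 eq. (6.6) and Lemma 60 (p. 49): for `d ≡ 0 mod m`
the set of **balanced** (equidistributed) multi-indices
`V_m^d = {𝐢 ∈ {1,…,m}^d : ∀ i, #{h : i_h = i} = d/m}` has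
`#V_m^d = binom(d; d/m, …, d/m) > m^d / C(d+m−1, m−1)` ("the `m`-fold expansion
`m^d = (1+⋯+1)^d = Σ_𝐣 binom(d; j_1,…,j_m)` has `C(d+m−1, m−1)` terms, the maximal of which is the
central multinomial coefficient"). Everything here is PROVED:

* `card_filter_profile_eq` — the number of maps `Fin d → Fin m` with prescribed fibre cardinalities
  `𝐣` is the multinomial coefficient `binom(d; 𝐣)` (coefficient extraction in
  `(X_1 + ⋯ + X_m)^d`, Mathlib's `MvPolynomial.coeff_sum_X_pow_of_fintype`);
* `multinomial_le_central` — the central multinomial coefficient is the largest;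
* `card_balanced` (`= binom(d; d/m,…,d/m)`) and **Lemma 60** `pow_le_card_balanced_mul_choose`:
  `m^d ≤ #V_m^d · C(d+m−1, m−1)` (CDT print the strict `>`, which fails for `m = 1`; the
  non-strict form is what is used).

## References

* [CalegariDimitrovTang2024] arXiv:2408.15403, §6.2 eq. (6.6), Lemma 60 (p. 49).
-/

namespace Literature.Combinatorics.Enumerative

namespace BalancedIndices

open Finset

/-! ### Fibre profiles and their count -/

/-- The fibre profile `a ↦ #{h : f h = a}` of a map `f : Fin d → Fin m`, as a finitely supported
function. [cite: CalegariDimitrovTang2024, §6.2 eq. (6.6)] -/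
noncomputable def profile {d m : ℕ} (f : Fin d → Fin m) : Fin m →₀ ℕ :=
  ∑ h : Fin d, Finsupp.single (f h) 1

/-- `profile f a = #{h : f h = a}`. [folklore] -/
theorem profile_apply {d m : ℕ} (f : Fin d → Fin m) (a : Fin m) :
    profile f a = (univ.filter fun h => f h = a).card := by
  classical
  rw [profile, Finsupp.finsetSum_apply]
  simp only [Finsupp.single_apply]
  rw [Finset.card_filter]

/-- `Σ_a profile f a = d`. [folklore] -/
theorem sum_profile {d m : ℕ} (f : Fin d → Fin m) : (profile f).sum (fun _ n => n) = d := by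
  classical
  rw [profile, ← Finsupp.sum_finsetSum_index (fun _ => rfl) (fun _ _ _ => rfl)]
  simp [Finsupp.sum_single_index]

/-- **Maps with prescribed fibre cardinalities are counted by the multinomial coefficient**:
`#{f : Fin d → Fin m : profile f = 𝐣} = binom(d; 𝐣)` if `Σ 𝐣 = d` (else `0`). Proof: compare the
coefficient of `X^𝐣` in the two expansions of `(X_1 + ⋯ + X_m)^d`. [folklore] -/
theorem card_filter_profile_eq {d m : ℕ} (j : Fin m →₀ ℕ) :
    ((univ.filter fun f : Fin d → Fin m => profile f = j).card : ℕ) =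
      if j.sum (fun _ n => n) = d then j.multinomial else 0 := by
  classical
  -- the coefficient of `X^j` in `(Σ X_a)^d`, computed in two ways (over `ℚ`)
  have h1 := MvPolynomial.coeff_sum_X_pow_of_fintype (R := ℚ) (σ := Fin m) j d
  have hexp : ((∑ a : Fin m, MvPolynomial.X a : MvPolynomial (Fin m) ℚ)) ^ d =
      ∑ f : Fin d → Fin m, MvPolynomial.monomial (profile f) (1 : ℚ) := by
    have hpow : ((∑ a : Fin m, MvPolynomial.X a : MvPolynomial (Fin m) ℚ)) ^ d =
        ∏ _h : Fin d, (∑ a : Fin m, MvPolynomial.X a : MvPolynomial (Fin m) ℚ) := by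
      rw [Finset.prod_const, Finset.card_univ, Fintype.card_fin]
    rw [hpow, Finset.prod_univ_sum (fun _ : Fin d => (univ : Finset (Fin m)))
      (fun _ a => (MvPolynomial.X a : MvPolynomial (Fin m) ℚ)), Fintype.piFinset_univ]
    refine Finset.sum_congr rfl fun f _ => ?_
    rw [profile, MvPolynomial.monomial_sum_one]
    refine Finset.prod_congr rfl fun h _ => ?_
    rw [MvPolynomial.X, MvPolynomial.monomial]
  rw [hexp, MvPolynomial.coeff_sum] at h1
  simp only [MvPolynomial.coeff_monomial] at h1
  rw [Finset.sum_boole] at h1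
  exact_mod_cast h1

/-! ### The central multinomial coefficient is the largest -/

/-- `q! · q^t ≤ t! · q^q` for all `t, q`. [folklore] -/
theorem factorial_mul_pow_le (t q : ℕ) : q.factorial * q ^ t ≤ t.factorial * q ^ q := by
  rcases le_or_gt q t with h | h
  · have h1 := Nat.factorial_mul_pow_sub_le_factorial h
    calc q.factorial * q ^ t = q.factorial * q ^ (t - q) * q ^ q := by
          rw [mul_assoc, ← pow_add, Nat.sub_add_cancel h]
      _ ≤ t.factorial * q ^ q := Nat.mul_le_mul_right _ h1
  · have h2 : t.factorial * q.descFactorial (q - t) = q.factorial := by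
      have := Nat.factorial_mul_descFactorial (show q - t ≤ q from Nat.sub_le q t)
      rwa [Nat.sub_sub_self h.le] at this
    have h3 := Nat.descFactorial_le_pow q (q - t)
    calc q.factorial * q ^ t = t.factorial * q.descFactorial (q - t) * q ^ t := by rw [h2]
      _ ≤ t.factorial * q ^ (q - t) * q ^ t := by gcongr
      _ = t.factorial * q ^ q := by rw [mul_assoc, ← pow_add, Nat.sub_add_cancel h.le]

/-- `(q!)^m ≤ ∏_a k_a!` whenever `Σ_a k_a = m q`. [folklore] -/
theorem pow_factorial_le_prod_factorial {m : ℕ} (k : Fin m → ℕ) {q : ℕ} (hk : ∑ a, k a = m * q) :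
    q.factorial ^ m ≤ ∏ a, (k a).factorial := by
  rcases Nat.eq_zero_or_pos q with hq | hq
  · subst hq
    simp only [Nat.factorial_zero, one_pow]
    exact Nat.one_le_iff_ne_zero.mpr (Finset.prod_ne_zero_iff.mpr fun a _ => Nat.factorial_ne_zero _)
  · have h := Finset.prod_le_prod' (s := (univ : Finset (Fin m))) fun a _ => factorial_mul_pow_le (k a) q
    rw [Finset.prod_mul_distrib, Finset.prod_mul_distrib, Finset.prod_pow_eq_pow_sum, hk,
      Finset.prod_const, Finset.prod_const, Finset.card_univ, Fintype.card_fin, ← pow_mul,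
      show q * m = m * q from mul_comm q m] at h
    exact Nat.le_of_mul_le_mul_right h (pow_pos hq _)

/-- **The central multinomial coefficient is maximal**: `binom(mq; k) ≤ binom(mq; q,…,q)` for every
`k` with `Σ k = m q`. [cite: CalegariDimitrovTang2024, §6.2 proof of Lemma 60] -/
theorem multinomial_le_central {m : ℕ} (k : Fin m → ℕ) {q : ℕ} (hk : ∑ a, k a = m * q) :
    Nat.multinomial univ k ≤ Nat.multinomial univ (fun _ : Fin m => q) := by
  have h1 := Nat.multinomial_spec univ k
  have h2 := Nat.multinomial_spec univ (fun _ : Fin m => q)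
  rw [hk] at h1
  simp only [Finset.sum_const, Finset.card_univ, Fintype.card_fin, smul_eq_mul, Finset.prod_const] at h2
  have h3 := pow_factorial_le_prod_factorial k hk
  have hpos : 0 < ∏ a, (k a).factorial := Finset.prod_pos fun a _ => Nat.factorial_pos _
  refine Nat.le_of_mul_le_mul_left ?_ hpos
  rw [h1, ← h2]
  exact Nat.mul_le_mul_right _ h3

/-! ### Lemma 60 -/

/-- The balanced multi-indices `V_m^d = {𝐢 : ∀ i, #{h : i_h = i} = d/m}`.
[cite: CalegariDimitrovTang2024, §6.2 eq. (6.6)] -/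
noncomputable def balanced (m d : ℕ) : Finset (Fin d → Fin m) :=
  univ.filter fun f => ∀ a, (univ.filter fun h => f h = a).card = d / m

/-- `#V_m^d = binom(d; d/m, …, d/m)` for `m ∣ d`. [cite: CalegariDimitrovTang2024, §6.2 Lemma 60] -/
theorem card_balanced {m d : ℕ} (hd : m ∣ d) :
    (balanced m d).card = Nat.multinomial univ (fun _ : Fin m => d / m) := by
  classical
  set j : Fin m →₀ ℕ := Finsupp.equivFunOnFinite.symm (fun _ => d / m) with hj
  have hjap : ∀ a, j a = d / m := fun a => rfl
  have hbal : balanced m d = univ.filter fun f : Fin d → Fin m => profile f = j := by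
    unfold balanced
    refine Finset.filter_congr fun f _ => ?_
    constructor
    · intro h; ext a; rw [profile_apply, h a, hjap]
    · intro h a; rw [← profile_apply, h, hjap]
  have hsum : j.sum (fun _ n => n) = d := by
    rw [Finsupp.sum_fintype _ _ (fun _ => rfl)]
    simp only [hjap, Finset.sum_const, Finset.card_univ, Fintype.card_fin, smul_eq_mul]
    exact Nat.mul_div_cancel' hd
  have h := card_filter_profile_eq (d := d) j
  rw [if_pos hsum, ← hbal] at h
  rw [h, Finsupp.multinomial_eq_of_support_subset (Finset.subset_univ _)]
  rfl

/-- `m^d = Σ_{𝐣} binom(d; 𝐣)` over the weak compositions `𝐣` of `d` into `m` parts.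
[cite: CalegariDimitrovTang2024, §6.2 proof of Lemma 60] -/
theorem pow_eq_sum_multinomial (m d : ℕ) :
    m ^ d = ∑ k ∈ (univ : Finset (Fin m)).piAntidiag d, Nat.multinomial univ k := by
  have h := Finset.sum_pow_eq_sum_piAntidiag (univ : Finset (Fin m)) (fun _ => (1 : ℕ)) d
  simp only [Finset.sum_const, Finset.card_univ, Fintype.card_fin, smul_eq_mul, mul_one, one_pow,
    Finset.prod_const_one] at h
  exact h

/-- The number of weak compositions of `d` into `m ≥ 1` parts is `C(d + m − 1, m − 1)`.
[folklore] -/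
theorem card_piAntidiag_univ_fin {m : ℕ} (hm : 0 < m) (d : ℕ) :
    ((univ : Finset (Fin m)).piAntidiag d).card = (d + m - 1).choose (m - 1) := by
  classical
  have h1 : ((univ : Finset (Fin m)).finsuppAntidiag d).card = ((univ : Finset (Fin m)).piAntidiag d).card := by
    rw [Finset.finsuppAntidiag, Finset.card_map, Finset.card_attach]
  rw [← h1, Finset.card_finsuppAntidiag_nat_eq_choose, Finset.card_univ, Fintype.card_fin]
  rw [show m + d - 1 = d + m - 1 by omega]
  exact Nat.choose_symm_of_eq_add (by omega)

/-- **CDT Lemma 60**: for `d ≡ 0 (mod m)`, `m ≥ 1`,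
`m^d ≤ #V_m^d · C(d + m − 1, m − 1)`, i.e. `#V_m^d ≥ m^d / C(d+m−1, m−1)`: the balanced
multi-indices have asymptotically full size `m^{d − o(d)}`.
[cite: CalegariDimitrovTang2024, §6.2 Lemma 60 (p. 49)] -/
theorem pow_le_card_balanced_mul_choose {m d : ℕ} (hm : 0 < m) (hd : m ∣ d) :
    m ^ d ≤ (balanced m d).card * (d + m - 1).choose (m - 1) := by
  rw [pow_eq_sum_multinomial, card_balanced hd, ← card_piAntidiag_univ_fin hm d, mul_comm]
  refine (Finset.sum_le_card_nsmul _ _ _ fun k hk => ?_).trans (by rw [smul_eq_mul])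
  rw [Finset.mem_piAntidiag] at hk
  exact multinomial_le_central k (q := d / m) (by rw [hk.1, Nat.mul_div_cancel' hd])

end BalancedIndices

end Literature.Combinatorics.Enumerative
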